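import Mathlib
import HarnessLib
import HarnessLib.Audit
import Summits.ValiantsHypothesis.ValiantsHypothesis.Theorems.LacunarySymmetroidMatrixDescartesZeroChangeConcavityBudgetDipTrain
import Summits.ValiantsHypothesis.ValiantsHypothesis.Theorems.LacunarySymmetroidMatrixDescartesZeroChangeConcavityBudgetRise

/-!
# ValiantsHypothesis / LacunarySymmetroid — crux `MatrixDescartes` (stmt-ValiantsHypothesis-18050, V1), LINE (A) «product_plus_one»:
# DIPS NEED KNEES — at a dip a definite fraction of the switched rows is past its knee

Thirteenth part of the concavity budget (✓ `…DipTrain`, ✓ `…Riccati`, ✓ `…Rise`).  Pure `(+,−,−)` company, `0 < a < c`, `m ≥ 1`, a dip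
`t` (`Φ′(t) = 0`, `Φ(t) ≠ 0`, `Φ(t)Φ″(t) ≥ 0`); `U = {g_j(t) > 0}`, `S = {g_j(t) < 0}`, and `K ⊆ S` the switched rows whose ROW WRONSKIAN
`W_j(t) = a²a₀a₁t^a + c²a₀a₂t^c + (c−a)²a₁a₂t^{a+c}` is `≥ 0` at `t` (rows PAST THEIR KNEE: their push `u_j = t g_j′/g_j` is rising, and keeps
rising — ✓ `rowWronskian_nonneg_persist`, ✓ `logDeriv_monotoneOn_of_rowWronskian_nonneg`).

* ★ `pureT5_dip_needs_knees` — `4a²·#S·m < c²·#U·#K`.  In words: at every dip at least the fraction `4a²m/(c²·#U) > 4a²/c²` of the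
  switched rows is past its knee.  Mechanism: the dip inequality says `Σ_j W_j/g_j² = a(a−c)M − Σφ_j² ≥ 0`; an unswitched row contributes
  `≤ −(a·b_j + b_j²)` (Riccati, ✓ `localExponent_sandwich`), a switched row `≤ c·u_j − u_j² ≤ c²/4` and `< 0` unless it is in `K`; with
  `B = Σ_U b_j > a·#S` (✓ `pureT5_dip_pull_bounds`) and Cauchy–Schwarz `Σ_U b_j² ≥ B²/#U`.

This is the first kernel link between DIPS and KNEES (the currency of the missing global charging: each row has ONE knee, ✓ `…Rise`/`…Knee`).

HONEST FRAMING: a structural inequality at a single dip, not a count; def-free, no named facts, no sorry, standard axioms; closes NO stub by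
name; `OneChangeFloorK3`, `MatrixDescartes` (stmt-ValiantsHypothesis-18050) OPEN; `VP ≠ VNP` is NOT proved and nothing here bears on it.

[folklore] Elementary algebra (Cauchy–Schwarz); no citation needed.
-/

set_option linter.dupNamespace false

namespace Summit.ValiantsHypothesis.ValiantsHypothesis.Theorems.LacunarySymmetroidMatrixDescartes

namespace ZeroChange

open Polynomial Finset

/-- ★ **DIPS NEED KNEES** (pure `(+,−,−)` company, `m ≥ 1`, `0 < a < c`): at a dip `t`, with `U`/`S` the rows positive/negative at `t`
and `K ⊆ S` those with nonnegative row Wronskian at `t`, `4a²·#S·m < c²·#U·#K`. -/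
theorem pureT5_dip_needs_knees (m a c : ℕ) (hm : 0 < m) (ha : 0 < a) (hac : a < c) (co : Fin m → ℝ × ℝ × ℝ)
    (hT5 : ∀ j, 0 < (co j).1 ∧ (co j).2.1 ≤ 0 ∧ (co j).2.2 ≤ 0 ∧ ((co j).2.1 < 0 ∨ (co j).2.2 < 0))
    {t : ℝ} (ht : 0 < t)
    (hΦ : (∏ j, row a c (co j).1 (co j).2.1 (co j).2.2).eval t ≠ 0)
    (hcrit : (derivative (∏ j, row a c (co j).1 (co j).2.1 (co j).2.2)).eval t = 0)
    (hdip : 0 ≤ (∏ j, row a c (co j).1 (co j).2.1 (co j).2.2).eval t *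
      (derivative (derivative (∏ j, row a c (co j).1 (co j).2.1 (co j).2.2))).eval t) :
    4 * (a : ℝ) ^ 2 * (univ.filter (fun j => ¬ 0 < (row a c (co j).1 (co j).2.1 (co j).2.2).eval t)).card * m <
      (c : ℝ) ^ 2 * (univ.filter (fun j => 0 < (row a c (co j).1 (co j).2.1 (co j).2.2).eval t)).card *
        ((univ.filter (fun j => ¬ 0 < (row a c (co j).1 (co j).2.1 (co j).2.2).eval t)).filter
          (fun j => 0 ≤ (a : ℝ) ^ 2 * (co j).1 * (co j).2.1 * t ^ a + (c : ℝ) ^ 2 * (co j).1 * (co j).2.2 * t ^ c +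
            ((c : ℝ) - a) ^ 2 * (co j).2.1 * (co j).2.2 * t ^ (a + c))).card := by
  have ha' : (0 : ℝ) < a := by exact_mod_cast ha
  have hc' : (0 : ℝ) < c := by exact_mod_cast (ha.trans hac)
  have hgt : ∀ j, (row a c (co j).1 (co j).2.1 (co j).2.2).eval t ≠ 0 := by
    intro j h0; apply hΦ; rw [eval_prod]; exact prod_eq_zero (mem_univ j) h0
  -- pull bounds at the dip: `S ≠ ∅`, `a·#S < B`
  obtain ⟨hSpos, haS, -⟩ := pureT5_dip_pull_bounds m a c hm ha hac co hT5 ht hΦ hcrit hdip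
  -- abbreviations
  set φ : Fin m → ℝ := fun j => t * (derivative (row a c (co j).1 (co j).2.1 (co j).2.2)).eval t /
    (row a c (co j).1 (co j).2.1 (co j).2.2).eval t with hφ
  set θN : Fin m → ℝ := fun j => (a : ℝ) ^ 2 * (co j).2.1 * t ^ a + (c : ℝ) ^ 2 * (co j).2.2 * t ^ c with hθN
  have hφj : ∀ j, φ j = ((a : ℝ) * (co j).2.1 * t ^ a + (c : ℝ) * (co j).2.2 * t ^ c) /
      (row a c (co j).1 (co j).2.1 (co j).2.2).eval t := by
    intro j; simp only [hφ]; rw [mul_eval_derivative_row]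
  -- (1) criticality `Σ φ = 0` and the sum `Σ θN_j/g_j = a²M + c²T`
  have hsum0 : ∑ j, φ j = 0 := by
    have h := eval_derivative_prod_rows m a c co hgt
    rw [hcrit] at h
    have hS : ∑ j, (derivative (row a c (co j).1 (co j).2.1 (co j).2.2)).eval t /
        (row a c (co j).1 (co j).2.1 (co j).2.2).eval t = 0 := (mul_eq_zero.1 h.symm).resolve_left hΦ
    have e : ∑ j, φ j = t * ∑ j, (derivative (row a c (co j).1 (co j).2.1 (co j).2.2)).eval t /
        (row a c (co j).1 (co j).2.1 (co j).2.2).eval t := by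
      rw [mul_sum]; refine sum_congr rfl fun j _ => ?_; simp only [hφ]; ring
    rw [e, hS, mul_zero]
  have hrel := critical_relation m a c co hΦ hcrit
  have hdipineq : ∑ j, φ j ^ 2 ≤ (a : ℝ) * ((a : ℝ) - c) * middleSum a c co t :=
    sum_sq_logDeriv_le_of_dip m a c co ht hΦ hcrit hdip
  have hθsum : ∑ j, θN j / (row a c (co j).1 (co j).2.1 (co j).2.2).eval t =
      (a : ℝ) ^ 2 * middleSum a c co t + (c : ℝ) ^ 2 * ∑ j, (co j).2.2 * t ^ c / (row a c (co j).1 (co j).2.1 (co j).2.2).eval t := by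
    rw [middleSum, mul_sum, mul_sum, ← sum_add_distrib]
    refine sum_congr rfl fun j _ => ?_
    simp only [hθN]
    ring
  -- the total `Σ_j (θN_j/g_j − φ_j²) ≥ 0`
  have htotal : 0 ≤ ∑ j, (θN j / (row a c (co j).1 (co j).2.1 (co j).2.2).eval t - φ j ^ 2) := by
    rw [sum_sub_distrib, hθsum]
    nlinarith [hrel, hdipineq]
  -- (2) per-row bounds
  set U := univ.filter (fun j => 0 < (row a c (co j).1 (co j).2.1 (co j).2.2).eval t) with hU
  set S := univ.filter (fun j => ¬ 0 < (row a c (co j).1 (co j).2.1 (co j).2.2).eval t) with hS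
  have hmemU : ∀ j, j ∈ U ↔ 0 < (row a c (co j).1 (co j).2.1 (co j).2.2).eval t := by
    intro j; rw [hU, mem_filter]; simp
  have hmemS : ∀ j, j ∈ S ↔ (row a c (co j).1 (co j).2.1 (co j).2.2).eval t < 0 := by
    intro j; rw [hS, mem_filter]; simp only [mem_univ, true_and, not_lt]
    exact ⟨fun h => lt_of_le_of_ne h (hgt j), fun h => h.le⟩
  have hsplit : ∑ j ∈ U, (θN j / (row a c (co j).1 (co j).2.1 (co j).2.2).eval t - φ j ^ 2) +
      ∑ j ∈ S, (θN j / (row a c (co j).1 (co j).2.1 (co j).2.2).eval t - φ j ^ 2) =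
      ∑ j, (θN j / (row a c (co j).1 (co j).2.1 (co j).2.2).eval t - φ j ^ 2) := by
    rw [hU, hS]; exact sum_filter_add_sum_filter_not _ _ _
  have hsplitφ : ∑ j ∈ U, φ j + ∑ j ∈ S, φ j = ∑ j, φ j := by
    rw [hU, hS]; exact sum_filter_add_sum_filter_not _ _ _
  -- unswitched rows: `θN_j/g_j − φ_j² ≤ a·φ_j − φ_j²`
  have hUrow : ∀ j ∈ U, θN j / (row a c (co j).1 (co j).2.1 (co j).2.2).eval t - φ j ^ 2 ≤ (a : ℝ) * φ j - φ j ^ 2 := by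
    intro j hj
    have hg : 0 < (row a c (co j).1 (co j).2.1 (co j).2.2).eval t := (hmemU j).1 hj
    obtain ⟨-, hq, hs, -⟩ := hT5 j
    have hsand := (localExponent_sandwich a c hac.le (co j).1 (co j).2.1 (co j).2.2 hq hs ht).2
    rw [mul_eval_derivative_row] at hsand
    have h1 : θN j / (row a c (co j).1 (co j).2.1 (co j).2.2).eval t ≤
        (a : ℝ) * (((a : ℝ) * (co j).2.1 * t ^ a + (c : ℝ) * (co j).2.2 * t ^ c) /
          (row a c (co j).1 (co j).2.1 (co j).2.2).eval t) := by
      rw [← mul_div_assoc]; exact div_le_div_of_nonneg_right hsand hg.le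
    rw [← hφj j] at h1
    linarith
  -- switched rows: `≤ c²/4`, and `≤ 0` off `K`
  have hSrow : ∀ j ∈ S, θN j / (row a c (co j).1 (co j).2.1 (co j).2.2).eval t - φ j ^ 2 ≤ (c : ℝ) ^ 2 / 4 := by
    intro j hj
    have hg : (row a c (co j).1 (co j).2.1 (co j).2.2).eval t < 0 := (hmemS j).1 hj
    obtain ⟨-, hq, hs, -⟩ := hT5 j
    have hsand := (localExponent_sandwich a c hac.le (co j).1 (co j).2.1 (co j).2.2 hq hs ht).1
    rw [mul_eval_derivative_row] at hsand
    have h1 : θN j / (row a c (co j).1 (co j).2.1 (co j).2.2).eval t ≤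
        (c : ℝ) * (((a : ℝ) * (co j).2.1 * t ^ a + (c : ℝ) * (co j).2.2 * t ^ c) /
          (row a c (co j).1 (co j).2.1 (co j).2.2).eval t) := by
      rw [← mul_div_assoc]; exact div_le_div_of_nonpos_of_le hg.le hsand
    rw [← hφj j] at h1
    nlinarith [sq_nonneg (φ j - (c : ℝ) / 2)]
  have hSrowK : ∀ j ∈ S, ¬ (0 ≤ (a : ℝ) ^ 2 * (co j).1 * (co j).2.1 * t ^ a + (c : ℝ) ^ 2 * (co j).1 * (co j).2.2 * t ^ c +
      ((c : ℝ) - a) ^ 2 * (co j).2.1 * (co j).2.2 * t ^ (a + c)) →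
      θN j / (row a c (co j).1 (co j).2.1 (co j).2.2).eval t - φ j ^ 2 ≤ 0 := by
    intro j hj hW
    have hg : (row a c (co j).1 (co j).2.1 (co j).2.2).eval t < 0 := (hmemS j).1 hj
    have hWev := rowWronskian_eval a c (co j).1 (co j).2.1 (co j).2.2 t
    -- `θN_j/g_j − φ_j² = W_j/g_j²`
    have e : θN j / (row a c (co j).1 (co j).2.1 (co j).2.2).eval t - φ j ^ 2 =
        ((row a c (co j).1 (co j).2.1 (co j).2.2).eval t * θN j -
          (t * (derivative (row a c (co j).1 (co j).2.1 (co j).2.2)).eval t) ^ 2) /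
          ((row a c (co j).1 (co j).2.1 (co j).2.2).eval t) ^ 2 := by
      simp only [hφ]
      field_simp
    rw [e]
    simp only [hθN] at hWev ⊢
    rw [hWev]
    exact div_nonpos_of_nonpos_of_nonneg (le_of_lt (not_le.1 hW)) (sq_nonneg _)
  -- (3) sum over `S`: `≤ (c²/4)·#K`
  set K := S.filter (fun j => 0 ≤ (a : ℝ) ^ 2 * (co j).1 * (co j).2.1 * t ^ a + (c : ℝ) ^ 2 * (co j).1 * (co j).2.2 * t ^ c +
      ((c : ℝ) - a) ^ 2 * (co j).2.1 * (co j).2.2 * t ^ (a + c)) with hK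
  have hSsum : ∑ j ∈ S, (θN j / (row a c (co j).1 (co j).2.1 (co j).2.2).eval t - φ j ^ 2) ≤ (c : ℝ) ^ 2 / 4 * K.card := by
    have hsplitS := sum_filter_add_sum_filter_not S
      (fun j => 0 ≤ (a : ℝ) ^ 2 * (co j).1 * (co j).2.1 * t ^ a + (c : ℝ) ^ 2 * (co j).1 * (co j).2.2 * t ^ c +
        ((c : ℝ) - a) ^ 2 * (co j).2.1 * (co j).2.2 * t ^ (a + c))
      (fun j => θN j / (row a c (co j).1 (co j).2.1 (co j).2.2).eval t - φ j ^ 2)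
    rw [← hK] at hsplitS
    have h1 : ∑ j ∈ K, (θN j / (row a c (co j).1 (co j).2.1 (co j).2.2).eval t - φ j ^ 2) ≤ ∑ j ∈ K, (c : ℝ) ^ 2 / 4 :=
      sum_le_sum fun j hj => hSrow j (by rw [hK, mem_filter] at hj; exact hj.1)
    rw [sum_const, nsmul_eq_mul] at h1
    have h2 : ∑ j ∈ S.filter (fun j => ¬ 0 ≤ (a : ℝ) ^ 2 * (co j).1 * (co j).2.1 * t ^ a +
        (c : ℝ) ^ 2 * (co j).1 * (co j).2.2 * t ^ c + ((c : ℝ) - a) ^ 2 * (co j).2.1 * (co j).2.2 * t ^ (a + c)),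
        (θN j / (row a c (co j).1 (co j).2.1 (co j).2.2).eval t - φ j ^ 2) ≤ 0 :=
      sum_nonpos fun j hj => by
        rw [mem_filter] at hj
        exact hSrowK j hj.1 hj.2
    linarith
  -- (4) sum over `U`: `≤ −(a·B + B²/#U)` with `B = Σ_U (−φ_j)`
  set B := ∑ j ∈ U, -φ j with hB
  have hUsumφ : ∑ j ∈ U, φ j = -B := by rw [hB, sum_neg_distrib, neg_neg]
  have hCS : B ^ 2 ≤ U.card * ∑ j ∈ U, φ j ^ 2 := by
    have h : (∑ j ∈ U, φ j) ^ 2 ≤ U.card * ∑ j ∈ U, φ j ^ 2 := sq_sum_le_card_mul_sum_sq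
    rw [hUsumφ, neg_sq] at h
    exact h
  have hUsum : ∑ j ∈ U, (θN j / (row a c (co j).1 (co j).2.1 (co j).2.2).eval t - φ j ^ 2) ≤
      -((a : ℝ) * B) - ∑ j ∈ U, φ j ^ 2 := by
    have h1 := sum_le_sum hUrow
    rw [sum_sub_distrib, sum_sub_distrib, ← mul_sum, hUsumφ] at h1
    rw [sum_sub_distrib]
    linarith
  -- (5) assemble: `0 ≤ total ≤ (c²/4)#K − aB − Σ_U φ² ≤ (c²/4)#K − aB − B²/#U`, and `B > a#S`
  have hBpos : 0 < B := lt_trans (mul_pos ha' (by exact_mod_cast hSpos)) haS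
  have hUne : U.Nonempty := by
    by_contra h0
    rw [not_nonempty_iff_eq_empty] at h0
    have : B = 0 := by rw [hB, h0, sum_empty]
    linarith
  have hUcard_pos : (0 : ℝ) < U.card := by exact_mod_cast hUne.card_pos
  have hScard : (0 : ℝ) < S.card := by exact_mod_cast hSpos
  have hm' : (S.card : ℝ) + U.card = m := by
    have h := card_filter_add_card_filter_not (s := (univ : Finset (Fin m)))
      (fun j => 0 < (row a c (co j).1 (co j).2.1 (co j).2.2).eval t)
    rw [card_univ, Fintype.card_fin, ← hU, ← hS] at h
    have h' : ((U.card + S.card : ℕ) : ℝ) = m := by exact_mod_cast h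
    push_cast at h'
    linarith
  have hchain : 0 ≤ (c : ℝ) ^ 2 / 4 * K.card - (a : ℝ) * B - ∑ j ∈ U, φ j ^ 2 := by linarith [htotal, hsplit, hSsum, hUsum]
  -- multiply by `#U > 0` and use Cauchy–Schwarz and `B > a#S`
  have h1 : (U.card : ℝ) * ((a : ℝ) * B + ∑ j ∈ U, φ j ^ 2) ≤ U.card * ((c : ℝ) ^ 2 / 4 * K.card) :=
    mul_le_mul_of_nonneg_left (by linarith) hUcard_pos.le
  have h2 : (U.card : ℝ) * ((a : ℝ) * B) + B ^ 2 ≤ U.card * ((c : ℝ) ^ 2 / 4 * K.card) := by linarith [h1, hCS]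
  have hB0 : 0 < (a : ℝ) * S.card := mul_pos ha' hScard
  have h3a : (U.card : ℝ) * (a : ℝ) * ((a : ℝ) * S.card) < (U.card : ℝ) * (a : ℝ) * B :=
    mul_lt_mul_of_pos_left haS (mul_pos hUcard_pos ha')
  have h3b : ((a : ℝ) * S.card) * ((a : ℝ) * S.card) < B * B := mul_self_lt_mul_self hB0.le haS
  rw [← hm']
  linarith [h2, h3a, h3b]

end ZeroChange

end Summit.ValiantsHypothesis.ValiantsHypothesis.Theorems.LacunarySymmetroidMatrixDescartes
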